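/-
Copyright (c) 2026. All rights reserved.
Released under Apache 2.0 license as described in the file LICENSE.
Authors: abc-iut cell, prover seat abc-iut-L4-t15 (gen 10).
-/
import Literature.IUT.LogVolume.UnitLogValuationSpectrum
import HarnessLib

/-!
# A member of `log_p(𝒪_K^×)` at a CYCLOTOMIC ramification index `e = p^c·(p−1)`: the level-2 logarithm
# `log_p(1 + ϖ²)` has norm `‖ϖ‖^{2·p^c − e·c} = ‖ϖ‖^{β + p^c}` EXACTLY (`β = p^c − e·c` the level-1 envelope)

Proof-only file (theorems, no definitions, no named fact), sequel of abc-iut-c312-3's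
`UnitLogMaxNorm.lean` / `UnitLogValuationSpectrum.lean` over abc-iut-S1's `LocalUnitLog.lean`
(`logUnits K = log_p(𝒪_K^×)`) and `RamificationInvariants.lean` (`e = absRamificationIdx p K`, norm
uniformizer `ϖ`, `‖ϖ‖ = p^{−1/e}`).  Setting: `K` ANY proper ultrametric normed `ℚ_p`-algebra field.

Classical content (Neukirch, *Algebraic Number Theory* II (5.5); Koblitz GTM 58 IV §1).  Off the cyclotomic
indices `e ∉ {p^a·(p−1)}` the largest norm on `log_p(𝒪_K^×)` is the level-1 envelope value `‖ϖ‖^β`,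
`β = min_a (p^a − e·a)`, attained by `log_p(1 + ϖ)` (`UnitLogMaxNorm.lean` §3).  AT a cyclotomic index
`e = p^c·(p−1)` (a TIE: the terms of index `p^c` and `p^{c+1}` of `log_p(1 + ϖ)` have the same norm and may
cancel) the value `‖ϖ‖^β` is attained only under a residue test (`UnitLogTieMaxNorm.lean`,
`UnitLogTieAttained.lean`: e.g. residue degree `≥ 2`), and can fail (`UnitLogTieNotAttained.lean`).  What is
proved HERE is the hypothesis-free substitute one level down:

* `strict_turning_two_of_tie` — for `p` odd and `e = p^c·(p−1)`, LEVEL 2 is tie-free with STRICT turning point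
  `c`: `2·p^b·(p−1) < e` for `b < c` and `e < 2·p^c·(p−1)`;
* **`exists_mem_logUnits_norm_eq_zpow_two_of_tie`** — hence `z = log_p(1 + ϖ²) ∈ log_p(𝒪_K^×)` has
  `‖z‖ = ‖ϖ‖^{2·p^c − e·c}` EXACTLY, for EVERY such `K` (no residue-degree / cyclotomic-type hypothesis);
  rpow form `exists_mem_logUnits_norm_eq_rpow_two_of_tie` (`= p^{−(2p^c − e·c)/e}`);
* `two_mul_pow_sub_le_min_add_pow` — `2·p^c − e·c ≤ min(p^a − a·e, p^b − b·e) + p^c` for all `a, b`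
  (`c` minimises the level-1 exponents `p^a − e·a`);
* **`exists_mem_logUnits_rpow_min_add_pow_le_norm_of_tie`** — the binder ("socket") form: at
  `e = p^c·(p−1)`, `p` odd, for all `a, b` some `z ∈ log_p(𝒪_K^×)` has
  `p^{−(min(p^a − a·e, p^b − b·e) + p^c)/e} ≤ ‖z‖` (loss of `p^c = e/(p−1)` `ϖ`-steps against the off-tie member);
* **`exists_mem_logUnits_rpow_min_add_one_le_norm_of_eq_sub_one`** — the FIRST tie `e = p − 1` (`c = 0`, ANY
  prime `p`): some `z ∈ log_p(𝒪_K^×)` has `p^{−(min(p^a − a·e, p^b − b·e) + 1)/e} ≤ ‖z‖` — the statement of the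
  abc-iut GAP-LEDGER row G-w5d107-g9-1 at `c = 0` (its only consumer instance: `p = 1231`, `e = 1230`), with the
  integer-numeral variants `…_of_eq_sub_one'` / `…_of_tie'` in the binder shape of `WRow.outer_member_min`.

SHARPNESS REMARK (not used, not formalised here): the loss `p^c` cannot be improved to `1` when `c ≥ 1`.  At
`K = ℚ_3(π)`, `π⁶ = −3` (`p = 3`, `e = 6 = 3·2`, `c = 1`, `β = −3`) the tied pair `π³/3 + π⁹/9 = (π³/3)(1 + π⁶/3)`
vanishes, the pair factor `‖1 − w⁶‖ ≤ ‖π‖³` for every unit `w`, and every unit logarithm has norm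
`≤ ‖π‖^{β+3} = 1 < ‖π‖^{β+1}`; so a member of norm `≥ p^{−(β+1)/e}` need not exist at a deeper tie.

Consumer (abc-iut D-0079 R-W lane, record only; GAP-LEDGER G-w5d107-g9-1, ruling C-R88 (b)): the
`(k, l) = (7, 41)` class of the HEX inhabited bands (abc-iut-w5-d107, `WRowHexLamSeven*`), whose side prime `1231`
has the admissible index `e = 1230 = 1231 − 1` where the off-tie member `WRow.outer_member_min` (hypothesis
`hne : ∀ c, e ≠ p^c(p−1)`) is unavailable; there `c = 0` and the member of this file has norm `p^{−2/e}`, the same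
element `log_p(1 + ϖ²)` as the level-2 off-tie socket member `WRow.outer_member_min_level_two` of abc-iut-w5-d107
(`Conditional/WRowOuterMemberLevelTwo.lean`, side condition `e ≠ 2·p^c·(p−1)`, `ρ_out = 2` at `a = 0`) — the
`c = 0` corollary below coincides with it; the general-`c` statement (loss `p^c`) is the new content.  The deeper
ties `c ≥ 1` of that fibre (`e = 1230·1231^c`) are out of the scope of the table cell.
Nothing here is disputed mathematics; no IUT statement is asserted; nothing bears on [IUTchIII] Cor. 3.12.
-/

noncomputable section

open Metric Set

namespace Literature.IUT.LogVolume

namespace LogEnvelope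

open RamificationCriterion Literature.NumberTheory.GaloisRepresentations.Ultrametric

/-! ### §1. Exponent arithmetic at a cyclotomic index -/

section Arith

variable {p : ℕ} [hp : Fact p.Prime]

/-- The integer form of a cyclotomic index: `e = p^c·(p−1)` in `ℤ`. [cite: NeukirchANT1999, Ch. II (5.5)] -/
theorem natCast_eq_pow_mul_sub_one_of_tie {e c : ℕ} (he : e = p ^ c * (p - 1)) :
    (e : ℤ) = (p : ℤ) ^ c * ((p : ℤ) - 1) := by
  rw [he]; push_cast [Nat.cast_sub hp.out.one_le]; ring

/-- **At a cyclotomic index `e = p^c·(p−1)` with `p` odd, `c` is a STRICT turning point of LEVEL 2**: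
`2·p^b·(p−1) < e` for `b < c` (since `2·p^b < 3·p^b ≤ p^{b+1} ≤ p^c`) and `e < 2·p^c·(p−1)`.
[cite: NeukirchANT1999, Ch. II (5.5)] -/
theorem strict_turning_two_of_tie (hp2 : p ≠ 2) {e c : ℕ} (he : e = p ^ c * (p - 1)) :
    (∀ b < c, ((2 : ℕ) : ℤ) * (p : ℤ) ^ b * ((p : ℤ) - 1) < e) ∧
      (e : ℤ) < ((2 : ℕ) : ℤ) * (p : ℤ) ^ c * ((p : ℤ) - 1) := by
  have heZ := natCast_eq_pow_mul_sub_one_of_tie (p := p) he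
  have hP3 : (3 : ℤ) ≤ (p : ℤ) := by
    have h2 := hp.out.two_le
    have h3 : 3 ≤ p := by omega
    exact_mod_cast h3
  have h1p : (1 : ℤ) ≤ (p : ℤ) := by linarith
  have h1 : (0 : ℤ) < (p : ℤ) - 1 := by linarith
  refine ⟨fun b hb => ?_, ?_⟩
  · rw [heZ]
    have hpb : (0 : ℤ) < (p : ℤ) ^ b := pow_pos (by linarith) b
    have hpow : (p : ℤ) ^ (b + 1) ≤ (p : ℤ) ^ c := pow_le_pow_right₀ h1p (Nat.succ_le_of_lt hb)
    rw [pow_succ] at hpow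
    have h3 : (p : ℤ) ^ b * 3 ≤ (p : ℤ) ^ b * (p : ℤ) := mul_le_mul_of_nonneg_left hP3 hpb.le
    have hlt : 2 * (p : ℤ) ^ b < (p : ℤ) ^ c := by linarith
    push_cast
    nlinarith
  · rw [heZ]
    have hpc : (0 : ℤ) < (p : ℤ) ^ c := pow_pos (by linarith) c
    push_cast
    linarith [mul_pos hpc h1]

/-- **At the first cyclotomic index `e = p − 1` (ANY prime `p`), `0` is a STRICT turning point of LEVEL 2**:
`e < 2·(p−1)`. [cite: NeukirchANT1999, Ch. II (5.5)] -/
theorem strict_turning_two_of_eq_sub_one {e : ℕ} (he : e = p - 1) :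
    (∀ b < 0, ((2 : ℕ) : ℤ) * (p : ℤ) ^ b * ((p : ℤ) - 1) < e) ∧
      (e : ℤ) < ((2 : ℕ) : ℤ) * (p : ℤ) ^ 0 * ((p : ℤ) - 1) := by
  have heZ : (e : ℤ) = (p : ℤ) - 1 := by rw [he]; push_cast [Nat.cast_sub hp.out.one_le]; ring
  have hP : (2 : ℤ) ≤ (p : ℤ) := by exact_mod_cast hp.out.two_le
  refine ⟨fun b hb => absurd hb (Nat.not_lt_zero b), ?_⟩
  rw [heZ, pow_zero]
  push_cast
  linarith

/-- **`c` minimises the level-1 exponents at `e = p^c·(p−1)`**: `p^c − e·c ≤ p^a − a·e` for every `a`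
(Bernoulli on both sides of the tie). [cite: NeukirchANT1999, Ch. II (5.5)] -/
theorem pow_sub_le_pow_sub_of_tie {e c : ℕ} (he : e = p ^ c * (p - 1)) (a : ℕ) :
    (p : ℤ) ^ c - (e : ℤ) * (c : ℤ) ≤ (p : ℤ) ^ a - (a : ℤ) * (e : ℤ) := by
  have heZ := natCast_eq_pow_mul_sub_one_of_tie (p := p) he
  have hP : (2 : ℤ) ≤ (p : ℤ) := by exact_mod_cast hp.out.two_le
  have hlo : ∀ b < c, (1 : ℤ) * (p : ℤ) ^ b * ((p : ℤ) - 1) < e := by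
    intro b hb
    rw [heZ]
    have hpow : (p : ℤ) ^ b < (p : ℤ) ^ c := pow_lt_pow_right₀ (by linarith) hb
    have h1 : (0 : ℤ) < (p : ℤ) - 1 := by linarith
    nlinarith
  have hhi : (e : ℤ) ≤ (1 : ℤ) * (p : ℤ) ^ c * ((p : ℤ) - 1) := by rw [heZ, one_mul]
  have h := exponent_min (S := 1) (P := (p : ℤ)) (E := (e : ℤ)) (a₀ := c) le_rfl hP hlo hhi a
  rw [one_mul, one_mul] at h
  linarith

/-- **The level-2 exponent against two level-1 exponents**: at `e = p^c·(p−1)`,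
`2·p^c − e·c ≤ min(p^a − a·e, p^b − b·e) + p^c` for all `a, b`. [cite: NeukirchANT1999, Ch. II (5.5)] -/
theorem two_mul_pow_sub_le_min_add_pow {e c : ℕ} (he : e = p ^ c * (p - 1)) (a b : ℕ) :
    ((2 : ℕ) : ℤ) * (p : ℤ) ^ c - (e : ℤ) * (c : ℤ) ≤
      min ((p : ℤ) ^ a - (a : ℤ) * (e : ℤ)) ((p : ℤ) ^ b - (b : ℤ) * (e : ℤ)) + (p : ℤ) ^ c := by
  have ha := pow_sub_le_pow_sub_of_tie (p := p) he a
  have hb := pow_sub_le_pow_sub_of_tie (p := p) he b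
  have hmin : (p : ℤ) ^ c - (e : ℤ) * (c : ℤ) ≤
      min ((p : ℤ) ^ a - (a : ℤ) * (e : ℤ)) ((p : ℤ) ^ b - (b : ℤ) * (e : ℤ)) := le_min ha hb
  push_cast
  linarith

/-- **Bernoulli at level 1**: `1 ≤ p^a − a·(p−1)` for every `a`, i.e. every level-1 exponent at `e = p − 1` is
`≥ 1`. [cite: NeukirchANT1999, Ch. II (5.5)] -/
theorem one_le_pow_sub_mul_sub_one (a : ℕ) : (1 : ℤ) ≤ (p : ℤ) ^ a - (a : ℤ) * ((p : ℤ) - 1) := by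
  have h := pow_sub_le_pow_sub_of_tie (p := p) (e := p - 1) (c := 0) (by rw [pow_zero, one_mul]) a
  have h1 : ((p - 1 : ℕ) : ℤ) = (p : ℤ) - 1 := by push_cast [Nat.cast_sub hp.out.one_le]; ring
  rw [h1] at h
  simpa using h

end Arith

/-! ### §2. The level-2 member at a cyclotomic index -/

section Field

variable (p : ℕ) [hp : Fact p.Prime]
variable {K : Type*} [NontriviallyNormedField K] [instK : NormedAlgebra ℚ_[p] K] [IsUltrametricDist K]
  [ProperSpace K]

/-- `‖ϖ‖^N = p^{−N/e}` (bookkeeping; `‖ϖ‖ = p^{−1/e}`). [cite: NeukirchANT1999, Ch. II (5.5)] -/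
theorem norm_unif_zpow_eq_rpow_div {ϖ : Kˣ} (hϖ : IsUniformizer ϖ) (N : ℤ) :
    ‖(ϖ : K)‖ ^ N = (p : ℝ) ^ (-((N : ℝ) / (absRamificationIdx p K : ℝ))) := by
  have hp0 : (0 : ℝ) ≤ p := by exact_mod_cast hp.out.pos.le
  rw [norm_eq_rpow_of_isUniformizer p K hϖ, ← Real.rpow_intCast, ← Real.rpow_mul hp0]
  congr 1
  ring

include instK in
/-- **THE LEVEL-2 MEMBER AT A CYCLOTOMIC INDEX**: if `e = p^c·(p−1)` and `p` is odd, then for every norm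
uniformizer `ϖ` some `z ∈ log_p(𝒪_K^×)` — namely `z = log_p(1 + ϖ²)` — has `‖z‖ = ‖ϖ‖^{2·p^c − e·c}` EXACTLY
(no residue-degree or cyclotomic-type hypothesis: level 2 is tie-free). [cite: NeukirchANT1999, Ch. II (5.5)] -/
theorem exists_mem_logUnits_norm_eq_zpow_two_of_tie {ϖ : Kˣ} (hϖ : IsUniformizer ϖ) (hp2 : p ≠ 2) {c : ℕ}
    (he : absRamificationIdx p K = p ^ c * (p - 1)) :
    ∃ z ∈ logUnits K, ‖z‖ = ‖(ϖ : K)‖ ^ (2 * (p : ℤ) ^ c - (absRamificationIdx p K : ℤ) * (c : ℤ)) := by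
  obtain ⟨hlo, hhi⟩ := strict_turning_two_of_tie (p := p) hp2 he
  obtain ⟨z, hz, hzn⟩ := exists_mem_logUnits_norm_eq_zpow_level p hϖ (a := 2) (by norm_num) hlo hhi
  exact ⟨z, hz, by simpa using hzn⟩

include instK in
/-- **The level-2 member at the FIRST cyclotomic index `e = p − 1`** (ANY prime `p`, `c = 0`): some
`z ∈ log_p(𝒪_K^×)` has `‖z‖ = ‖ϖ‖²` exactly. [cite: NeukirchANT1999, Ch. II (5.5)] -/
theorem exists_mem_logUnits_norm_eq_sq_of_eq_sub_one {ϖ : Kˣ} (hϖ : IsUniformizer ϖ)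
    (he : absRamificationIdx p K = p - 1) :
    ∃ z ∈ logUnits K, ‖z‖ = ‖(ϖ : K)‖ ^ (2 : ℤ) := by
  obtain ⟨hlo, hhi⟩ := strict_turning_two_of_eq_sub_one (p := p) he
  obtain ⟨z, hz, hzn⟩ := exists_mem_logUnits_norm_eq_zpow_level p hϖ (a := 2) (by norm_num) hlo hhi
  exact ⟨z, hz, by simpa using hzn⟩

include instK in
/-- **rpow form**: at `e = p^c·(p−1)`, `p` odd, some `z ∈ log_p(𝒪_K^×)` has `‖z‖ = p^{−(2·p^c − e·c)/e}`.
[cite: NeukirchANT1999, Ch. II (5.5)] -/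
theorem exists_mem_logUnits_norm_eq_rpow_two_of_tie (hp2 : p ≠ 2) {c : ℕ}
    (he : absRamificationIdx p K = p ^ c * (p - 1)) :
    ∃ z ∈ logUnits K, ‖z‖ = (p : ℝ) ^
      (-(((2 * (p : ℤ) ^ c - (absRamificationIdx p K : ℤ) * (c : ℤ) : ℤ) : ℝ) / (absRamificationIdx p K : ℝ))) := by
  obtain ⟨ϖ, hϖ⟩ := exists_isUniformizer (F := K)
  obtain ⟨z, hz, hzn⟩ := exists_mem_logUnits_norm_eq_zpow_two_of_tie p hϖ hp2 he
  exact ⟨z, hz, by rw [hzn, norm_unif_zpow_eq_rpow_div p hϖ]⟩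

include instK in
/-- **Socket form at a cyclotomic index** (`p` odd): if `e = p^c·(p−1)` then for all `a, b` some
`z ∈ log_p(𝒪_K^×)` has `p^{−(min(p^a − a·e, p^b − b·e) + p^c)/e} ≤ ‖z‖` — the off-tie outer member
(`WRow.outer_member_min`, exponent `min(p^a − a·e, p^b − b·e)`) with a loss of `p^c = e/(p−1)` steps.
[cite: NeukirchANT1999, Ch. II (5.5)] -/
theorem exists_mem_logUnits_rpow_min_add_pow_le_norm_of_tie (hp2 : p ≠ 2) {e c : ℕ}
    (hE : absRamificationIdx p K = e) (he : e = p ^ c * (p - 1)) (a b : ℕ) :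
    ∃ z ∈ logUnits K, (p : ℝ) ^ (-(((min ((p : ℤ) ^ a - (a : ℤ) * (e : ℤ)) ((p : ℤ) ^ b - (b : ℤ) * (e : ℤ))
      + (p : ℤ) ^ c : ℤ) : ℝ) / (e : ℝ))) ≤ ‖z‖ := by
  subst hE
  obtain ⟨z, hz, hzn⟩ := exists_mem_logUnits_norm_eq_rpow_two_of_tie p hp2 he
  refine ⟨z, hz, ?_⟩
  rw [hzn]
  have hp1 : (1 : ℝ) ≤ (p : ℝ) := by exact_mod_cast hp.out.one_lt.le
  have he0 : (0 : ℝ) < (absRamificationIdx p K : ℝ) := by exact_mod_cast absRamificationIdx_pos p K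
  have hle := two_mul_pow_sub_le_min_add_pow (p := p) he a b
  have hle' : (((2 * (p : ℤ) ^ c - (absRamificationIdx p K : ℤ) * (c : ℤ) : ℤ) : ℝ)) ≤
      ((min ((p : ℤ) ^ a - (a : ℤ) * (absRamificationIdx p K : ℤ))
        ((p : ℤ) ^ b - (b : ℤ) * (absRamificationIdx p K : ℤ)) + (p : ℤ) ^ c : ℤ) : ℝ) := by
    exact_mod_cast hle
  refine Real.rpow_le_rpow_of_exponent_le hp1 ?_
  rw [neg_le_neg_iff]
  exact div_le_div_of_nonneg_right hle' he0.le

include instK in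
/-- **Socket form at the FIRST cyclotomic index `e = p − 1`** (ANY prime `p`; the statement of the abc-iut
GAP-LEDGER row G-w5d107-g9-1 at `c = 0`): for all `a, b` some `z ∈ log_p(𝒪_K^×)` has
`p^{−(min(p^a − a·e, p^b − b·e) + 1)/e} ≤ ‖z‖` (`z = log_p(1 + ϖ²)`, `‖z‖ = ‖ϖ‖² = p^{−2/e}`, and every level-1
exponent is `≥ 1`). [cite: NeukirchANT1999, Ch. II (5.5)] -/
theorem exists_mem_logUnits_rpow_min_add_one_le_norm_of_eq_sub_one {e : ℕ}
    (hE : absRamificationIdx p K = e) (he : e = p - 1) (a b : ℕ) :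
    ∃ z ∈ logUnits K, (p : ℝ) ^ (-(((min ((p : ℤ) ^ a - (a : ℤ) * (e : ℤ)) ((p : ℤ) ^ b - (b : ℤ) * (e : ℤ))
      + 1 : ℤ) : ℝ) / (e : ℝ))) ≤ ‖z‖ := by
  subst hE
  obtain ⟨ϖ, hϖ⟩ := exists_isUniformizer (F := K)
  obtain ⟨z, hz, hzn⟩ := exists_mem_logUnits_norm_eq_sq_of_eq_sub_one p hϖ he
  refine ⟨z, hz, ?_⟩
  rw [hzn, norm_unif_zpow_eq_rpow_div p hϖ]
  have hp1 : (1 : ℝ) ≤ (p : ℝ) := by exact_mod_cast hp.out.one_lt.le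
  have he0 : (0 : ℝ) < (absRamificationIdx p K : ℝ) := by exact_mod_cast absRamificationIdx_pos p K
  have heZ : (absRamificationIdx p K : ℤ) = (p : ℤ) - 1 := by
    rw [he]; push_cast [Nat.cast_sub hp.out.one_le]; ring
  have ha := one_le_pow_sub_mul_sub_one (p := p) a
  have hb := one_le_pow_sub_mul_sub_one (p := p) b
  rw [← heZ] at ha hb
  have hmin : (1 : ℤ) ≤ min ((p : ℤ) ^ a - (a : ℤ) * (absRamificationIdx p K : ℤ))
      ((p : ℤ) ^ b - (b : ℤ) * (absRamificationIdx p K : ℤ)) := le_min ha hb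
  have hle' : ((2 : ℤ) : ℝ) ≤ ((min ((p : ℤ) ^ a - (a : ℤ) * (absRamificationIdx p K : ℤ))
      ((p : ℤ) ^ b - (b : ℤ) * (absRamificationIdx p K : ℤ)) + 1 : ℤ) : ℝ) := by
    have : (2 : ℤ) ≤ min ((p : ℤ) ^ a - (a : ℤ) * (absRamificationIdx p K : ℤ))
        ((p : ℤ) ^ b - (b : ℤ) * (absRamificationIdx p K : ℤ)) + 1 := by linarith
    exact_mod_cast this
  refine Real.rpow_le_rpow_of_exponent_le hp1 ?_
  rw [neg_le_neg_iff]
  exact div_le_div_of_nonneg_right hle' he0.le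

include instK in
/-- **Binder shape of `WRow.outer_member_min`, first cyclotomic index**: with the prime read as an integer
numeral `p'` and `ρ = min(p'^a − a·e, p'^b − b·e)` named, `e = p − 1` gives a member of norm `≥ p^{−(ρ+1)/e}`.
[cite: NeukirchANT1999, Ch. II (5.5)] -/
theorem exists_mem_logUnits_rpow_min_add_one_le_norm_of_eq_sub_one' {e : ℕ}
    (hE : absRamificationIdx p K = e) (he : e = p - 1) (a b : ℕ) {p' : ℤ} (hp' : (p : ℤ) = p')
    {ρ : ℤ} (hρ : ρ = min (p' ^ a - (a : ℤ) * (e : ℤ)) (p' ^ b - (b : ℤ) * (e : ℤ))) :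
    ∃ z ∈ logUnits K, (p : ℝ) ^ (-(((ρ + 1 : ℤ) : ℝ) / (e : ℝ))) ≤ ‖z‖ := by
  subst hp' hρ
  exact exists_mem_logUnits_rpow_min_add_one_le_norm_of_eq_sub_one p hE he a b

include instK in
/-- **Binder shape of `WRow.outer_member_min`, any cyclotomic index** (`p` odd): with `p'`, `ρ` as above and
`e = p^c·(p−1)`, a member of norm `≥ p^{−(ρ + p^c)/e}`. [cite: NeukirchANT1999, Ch. II (5.5)] -/
theorem exists_mem_logUnits_rpow_min_add_pow_le_norm_of_tie' (hp2 : p ≠ 2) {e c : ℕ}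
    (hE : absRamificationIdx p K = e) (he : e = p ^ c * (p - 1)) (a b : ℕ) {p' : ℤ} (hp' : (p : ℤ) = p')
    {ρ : ℤ} (hρ : ρ = min (p' ^ a - (a : ℤ) * (e : ℤ)) (p' ^ b - (b : ℤ) * (e : ℤ))) :
    ∃ z ∈ logUnits K, (p : ℝ) ^ (-(((ρ + p' ^ c : ℤ) : ℝ) / (e : ℝ))) ≤ ‖z‖ := by
  subst hp' hρ
  exact exists_mem_logUnits_rpow_min_add_pow_le_norm_of_tie p hp2 hE he a b

end Field

end LogEnvelope

end Literature.IUT.LogVolume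

end
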